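import Summits.Langlands.Langlands.Statement
import Literature.NumberTheory.Automorphic.IsAutomorphicAE
import Literature.NumberTheory.GaloisRepresentations.ResidualGaloisRep
import Literature.NumberTheory.GaloisRepresentations.OrdinaryTwistedDeterminant
import Literature.NumberTheory.GaloisRepresentations.LabelledHodgeTateWeights
import HarnessLib
/-!
# `WeightOneFMBeyondTaylorWilesQ` — F4 ON-PATH CERTIFICATE (G4 ladder-down generation 12 on
# `ReciprocityUpToIrreducibility`, item stmt-Langlands-14328)

`theorem WeightOneFMBeyondTaylorWilesQ_of_Langlands : Langlands → WeightOneFMBeyondTaylorWilesQ` (no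
`sorry`): the summit's clause (B) for `n = 2`, `K = ℚ` and ANY reciprocity datum (one exists by the
summit's `Nonempty` clause) gives, for an irreducible `ρ` in the weight-one sector — geometric because
`ReciprocityData.pst ℓ v hv = fontainePstAdicCompletion v ℓ hv` by `rfl` and the sector clause supplies
de Rham-ness at `v ∣ p` and a.e. unramifiedness — an L-algebraic cuspidal `π` with `Corresponds`, whose
first conjunct is `SatakeFrobCompatibleAE`.  The same proof gives every rung `weightOneFM_of_langlands θ`.
(The ladder top itself also implies the rung: `weightOneFM_of_top` in the skeleton `Lines/…lean`.)
-/
noncomputable section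

set_option linter.dupNamespace false

open scoped MatrixGroups Matrix NumberField Classical
open NumberField IsDedekindDomain Field Filter
open Literature.NumberTheory.Automorphic Literature.NumberTheory.GaloisRepresentations
open Literature.NumberTheory.PAdicHodge
open Summit.Langlands

namespace Summit.Langlands.Langlands.Cruxes.ReciprocityUpToIrreducibility.WeightOneFMBeyondTaylorWilesQ

/-! ## The sector clauses -/

/-- **Weight-one sector at `p`**: `ρ|Γ_{ℚ_v}` (`v = (p)`) is DE RHAM for Fontaine's PINNED datum
`fontainePstAdicCompletion v p hv` and its `τ`-labelled Hodge–Tate weights are `{0, 0}` for every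
continuous label `τ : ℚ_v → ℚ̄_p` (Pan: "`ρ|G_{ℚ_p}` is Hodge–Tate of weights `0,0`"; Hodge–Tate of
weights `0,0` ⇒ potentially unramified (Sen) ⇒ de Rham, so the de Rham clause only makes the rendered
hypothesis formally stronger). -/
def DeRhamWeightZeroAt (p : ℕ) [Fact p.Prime] (ρ : FramedGaloisRep ℚ (PadicAlgCl p) 2) : Prop :=
  ∀ (v : HeightOneSpectrum (𝓞 ℚ)) (hv : ((p : ℕ) : 𝓞 ℚ) ∈ v.asIdeal),
    (fontainePstAdicCompletion v p hv).IsDeRhamFramed (ρ.toLocal v) ∧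
    ∀ τ : v.adicCompletion ℚ →+* PadicAlgCl p, Continuous τ →
      ρ.labelledHodgeTateWeightsAt v (fontainePstAdicCompletion v p hv).algebra
        (fontainePstAdicCompletion v p hv).𝔅 τ = {0, 0}

/-- **Local genericity at `p`** (Pan 2022 Thm 1.0.5, last hypothesis): `(ρ̄|Γ_{ℚ_p})^ss` is either
irreducible or `η₁ ⊕ η₂` with `η₁/η₂ ≠ 1, ω^{±1}`.  Trace rendering (Brauer–Nesbitt, `p > 2`):
there are NO finite-order characters `η₁, η₂ : Γ_{ℚ_v} → ℚ̄_pˣ` with `tr ρ|Γ_{ℚ_v} ≡ η₁ + η₂ (mod 𝔪)`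
and `η₁ ≡ η₂`, `η₁ ≡ ε η₂` or `η₂ ≡ ε η₁ (mod 𝔪)` (`ε` = the `p`-adic cyclotomic character of
`Γ_{ℚ_v}`, `ε ≡ ω`). -/
def LocallyGenericAt (p : ℕ) [Fact p.Prime] (ρ : FramedGaloisRep ℚ (PadicAlgCl p) 2) : Prop :=
  ∀ (v : HeightOneSpectrum (𝓞 ℚ)), ((p : ℕ) : 𝓞 ℚ) ∈ v.asIdeal →
    ¬ ∃ η₁ η₂ : absoluteGaloisGroup (v.adicCompletion ℚ) →* (PadicAlgCl p)ˣ,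
      IsOpen (η₁.ker : Set (absoluteGaloisGroup (v.adicCompletion ℚ))) ∧
      IsOpen (η₂.ker : Set (absoluteGaloisGroup (v.adicCompletion ℚ))) ∧
      (∀ σ, ‖(ρ.toLocal v σ).val.trace - ((η₁ σ : PadicAlgCl p) + (η₂ σ : PadicAlgCl p))‖ < 1) ∧
      ((∀ σ, ‖(η₁ σ : PadicAlgCl p) - (η₂ σ : PadicAlgCl p)‖ < 1) ∨
       (∀ σ, ‖(η₁ σ : PadicAlgCl p) -
          (cyclotomicPadicAlgCl (v.adicCompletion ℚ) p σ : PadicAlgCl p) * (η₂ σ : PadicAlgCl p)‖ < 1) ∨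
       (∀ σ, ‖(η₂ σ : PadicAlgCl p) -
          (cyclotomicPadicAlgCl (v.adicCompletion ℚ) p σ : PadicAlgCl p) * (η₁ σ : PadicAlgCl p)‖ < 1))

/-- **The Taylor–Wiles hypothesis** (Pan 2022 Thm 1.0.5, fourth hypothesis): `ρ̄|Γ_{ℚ(μ_p)}` is
(absolutely) irreducible — the accepted predicate `FramedGaloisRep.IsResiduallyAbsIrreducible` on the
restriction to `Γ_{ℚ(ζ_p)}`, exactly as in the tree's facts `Tung2021_fontaineMazurGL2`,
`XZhang2024_fontaineMazurGL2_tateTwist`. -/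
def TaylorWilesHypothesis (p : ℕ) [Fact p.Prime] (ρ : FramedGaloisRep ℚ (PadicAlgCl p) 2) : Prop :=
  (ρ.restrictField (CyclotomicField p ℚ)).IsResiduallyAbsIrreducible

/-! ## The family and the rung -/

/-- **The rung family** `E(θ)` — Taylor–Wiles depth `θ` of the weight-one Fontaine–Mazur theorem over
`ℚ`: for every odd prime `p` and every continuous irreducible, a.e. unramified, odd
`ρ : Γ_ℚ → GL₂(ℚ̄_p)` in the weight-one sector (`DeRhamWeightZeroAt`), subject to the residual clauses
`θ ≤ 1 →` local genericity and `θ = 0 →` Taylor–Wiles, there is an L-algebraic cuspidal `π` of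
`GL₂(𝔸_ℚ)` attached to `ρ` at almost all places.  `θ = 0`: Pan 2022 Thm 1.0.5 (FLOOR, in print);
`θ = 1`: THE RUNG (open: residually reducible / cyclotomic-dihedral weight one); `θ ≥ 2`: full
weight-one Fontaine–Mazur over `ℚ` (open).
[cite: Pan2022LocallyAnalytic, Thm. 1.0.5, Rem. 1.0.6, Rem. 6.4.10] -/
def WeightOneFM (θ : ℕ) : Prop :=
  ∀ (p : ℕ) [Fact p.Prime], p ≠ 2 →
    ∀ (hcpt : isCompact_glFiniteIntegralLevel 2 ℚ) (ι : PadicAlgCl p ≃+* ℂ)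
      (ρ : FramedGaloisRep ℚ (PadicAlgCl p) 2),
      ρ.toGaloisRep.IsIrreducible →
      (∀ᶠ v : HeightOneSpectrum (𝓞 ℚ) in cofinite, ρ.IsUnramifiedAt v) →
      ρ.IsOdd →
      DeRhamWeightZeroAt p ρ →
      (θ ≤ 1 → LocallyGenericAt p ρ) →
      (θ = 0 → TaylorWilesHypothesis p ρ) →
      ∃ π : CuspidalAutomorphicRepData 2 ℚ hcpt, π.1.IsLAlgebraic ∧ SatakeFrobCompatibleAE ι π.1 ρ

/-- **THE RUNG** (the filed statement): the family at `θ = 1` — the weight-one Fontaine–Mazur theorem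
over `ℚ` WITHOUT the Taylor–Wiles hypothesis (residually reducible and cyclotomic-dihedral `ρ̄`
admitted), the local genericity at `p` kept. -/
def WeightOneFMBeyondTaylorWilesQ : Prop := WeightOneFM 1

/-! ## Dial monotonicity -/

/-- The dial is monotone: a deeper rung implies every shallower one. -/
theorem mono {θ θ' : ℕ} (hle : θ ≤ θ') (h : WeightOneFM θ') : WeightOneFM θ := by
  intro p _ hp hcpt ι ρ hirr hunr hodd hdr hgen htw
  exact h p hp hcpt ι ρ hirr hunr hodd hdr (fun h1 => hgen (by omega)) (fun h0 => htw (by omega))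

theorem mono_one_zero (h : WeightOneFMBeyondTaylorWilesQ) : WeightOneFM 0 := mono (by norm_num) h

theorem mono_two_one (h : WeightOneFM 2) : WeightOneFMBeyondTaylorWilesQ := mono (by norm_num) h

/-! ## On-path: the summit implies every rung -/

/-- **ON-PATH** (F4): `Langlands → E(θ)` for EVERY `θ`: clause (B) of the summit at any reciprocity
datum (one exists by the `Nonempty` conjunct) applies to every `ρ` of the sector — the de Rham clause is
stated against the PINNED Fontaine datum `fontainePstAdicCompletion v p hv = Rec.pst p v hv` (`rfl`), so
the sector gives `IsGeometricFramed Rec ρ`; `Corresponds Rec ι π ρ` contains `SatakeFrobCompatibleAE ι π ρ`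
as its first conjunct.  Oddness, the weights and the residual clauses are not used. -/
theorem weightOneFM_of_langlands (θ : ℕ) (hL : _root_.Langlands) : WeightOneFM θ := by
  intro p _ _hp hcpt ι ρ hirr hunr _hodd hdr _hgen _htw
  obtain ⟨⟨Rec⟩, hall⟩ := hL ℚ
  have hB : GaloisToAutomorphic 2 Rec hcpt := (hall Rec 2 two_pos hcpt).2
  have hdR : ∀ (v : HeightOneSpectrum (𝓞 ℚ)) (hv : ((p : ℕ) : 𝓞 ℚ) ∈ v.asIdeal),
      (Rec.pst p v hv).IsDeRhamFramed (ρ.toLocal v) := by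
    intro v hv
    change (fontainePstAdicCompletion v p hv).IsDeRhamFramed (ρ.toLocal v)
    exact (hdr v hv).1
  have hgeo : IsGeometricFramed Rec ρ := ⟨hunr, hdR⟩
  obtain ⟨π, hπL, hcorr⟩ := hB p ι ρ hirr hgeo
  refine ⟨π, hπL, ?_⟩
  filter_upwards [hcorr.1] with v hv
  exact hv

/-- **F4 on-path lemma for the rung**: `Langlands → WeightOneFMBeyondTaylorWilesQ`. -/
@[aesop safe apply]
theorem WeightOneFMBeyondTaylorWilesQ_of_Langlands (hL : _root_.Langlands) :
    WeightOneFMBeyondTaylorWilesQ :=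
  weightOneFM_of_langlands 1 hL

example : _root_.Langlands → WeightOneFMBeyondTaylorWilesQ := by intro h; aesop

end Summit.Langlands.Langlands.Cruxes.ReciprocityUpToIrreducibility.WeightOneFMBeyondTaylorWilesQ

end
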